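import Summits.FinalStateConjecture.FinalStateConjecture.Theorems.EIHFluxBalanceInertialRecessionStubMomRowLinearRow
import Summits.FinalStateConjecture.FinalStateConjecture.Theorems.EIHFluxBalanceInertialRecessionStubSlaving3Coercive

/-!
# Route EIHFluxBalance — `InertialRecession` (E′), line `SketchCleanExcision`, skeleton r13:
# registered stub `stub_momRowLinear` (ML) — the momentum rows are linear in the normal jets,
# with a bound linear in `‖DG‖`

Helper file for the crux `stmt-FinalStateConjecture-17403`
(`Summit.FinalStateConjecture.FinalStateConjecture.Theses.EIHFluxBalance.InertialRecession`, E′),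
line `SketchCleanExcision`, skeleton r13 (design memo `DESIGN-r13.md`), registered stub ML — the
algebraic heart of the "linear architecture": for metric component fields on `E4` with the same
value at `x` and jets differing along a covector `n` by normal data `(A, P, W)`, the mixed Ricci
components `Ric(♯n, e)`, `n(e) = 0` (for `n = dx⁰` the momentum-constraint rows `G⁰ⱼ`)
(i) depend additively and homogeneously on `(A, P)` and not on `W`, and (ii) are bounded by
`C(μ)(1 + ‖DG(x)‖)(‖A‖ + ‖P‖)‖n‖²‖e‖` when `G(x)` is `μ`-coercive.

* `momRow_norm_lin_le` — the linear part `Lin_{A,P}(X,Y,Z)` of the curvature change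
  (`momRow_riemAt_sub_eq`, companion file …StubMomRowLinearRow) is bounded by
  `15 s² (1 + ‖DG‖)(‖A‖ + ‖P‖)‖n‖‖X‖‖Y‖‖Z‖` for `‖♯‖ ≤ s`, `1 ≤ s` (term by term);
* `momRow_abs_ricAt_sub_le` — with the momentum-row formula:
  `|Ric'(♯n,e) − Ric(♯n,e)| ≤ (Σᵢ‖bⁱ‖‖bᵢ‖) 15 s³ (1 + ‖DG(x)‖)(‖A‖ + ‖P‖)‖n‖²‖e‖`;
* `stub_momRowLinear` — **the registered statement (i) ∧ (ii)** on `E4` (`n = 0` trivial;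
  otherwise `A` is symmetric, `momRow_symm_of_jet₁`; `‖♯‖ ≤ μ⁻¹` by coercivity,
  `norm_sharpAt_le_of_coercive`).

No definitions, no named facts, no `sorry`.
-/

set_option linter.dupNamespace false
set_option maxSynthPendingDepth 3

noncomputable section

open Set Function ContinuousLinearMap Literature.Geometry.Lorentzian
  Literature.Geometry.Lorentzian.MetricCoord

namespace Summit.FinalStateConjecture.FinalStateConjecture.Theorems.SublinearIsFree.Slaving

section Bound

variable {E : Type*} [NormedAddCommGroup E] [NormedSpace ℝ E] [CompleteSpace E]
  {G G' : E → E →L[ℝ] E →L[ℝ] ℝ} {V : Set E} {x : E} {n : E →L[ℝ] ℝ} {A : E →L[ℝ] E →L[ℝ] ℝ}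

set_option maxHeartbeats 800000 in
/-- **Bound on the linear part of the curvature change**:
`‖Lin_{A,P}(X,Y,Z)‖ ≤ 15 s² (1 + ‖DG(x)‖)(‖A‖ + ‖P‖)‖n‖‖X‖‖Y‖‖Z‖` for `‖♯‖ ≤ s`, `1 ≤ s`
(term by term: `‖dK(a,c)‖ ≤ 3‖n‖‖A‖‖a‖‖c‖`, `‖D♯(v)‖ ≤ s²‖DG‖‖v‖`, `‖K(a)c‖ ≤ 3‖DG‖‖a‖‖c‖`,
`‖Γ(a)‖ ≤ (3/2)s‖DG‖‖a‖`, `‖koszulOp T(a)‖ ≤ 3‖T‖‖a‖`). [folklore] -/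
theorem momRow_norm_lin_le (hG : IsMetricOn G V) (hx : x ∈ V) {s : ℝ} (h1s : 1 ≤ s)
    (hs : ‖sharpAt G x‖ ≤ s) (P : E →L[ℝ] E →L[ℝ] E →L[ℝ] ℝ) (X Y Z : E) :
    ‖((2⁻¹ : ℝ) • (fderiv ℝ (sharpAt G) x X (n Y • A Z + n Z • A.flip Y - A Y Z • n) - n X • sharpAt G x (A (sharpAt G x (koszulCLM G x Y Z))) + sharpAt G x (koszulOp (n X • P + n.smulRight (P X)) Y Z))
        - (2⁻¹ : ℝ) • (fderiv ℝ (sharpAt G) x Y (n X • A Z + n Z • A.flip X - A X Z • n) - n Y • sharpAt G x (A (sharpAt G x (koszulCLM G x X Z))) + sharpAt G x (koszulOp (n Y • P + n.smulRight (P Y)) X Z))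
        + (chrAt G x X ((2⁻¹ : ℝ) • sharpAt G x (n Y • A Z + n Z • A.flip Y - A Y Z • n)) + (2⁻¹ : ℝ) • sharpAt G x (n X • A (chrAt G x Y Z) + n (chrAt G x Y Z) • A.flip X - A X (chrAt G x Y Z) • n))
        - (chrAt G x Y ((2⁻¹ : ℝ) • sharpAt G x (n X • A Z + n Z • A.flip X - A X Z • n)) + (2⁻¹ : ℝ) • sharpAt G x (n Y • A (chrAt G x X Z) + n (chrAt G x X Z) • A.flip Y - A Y (chrAt G x X Z) • n)))‖
      ≤ 15 * s ^ 2 * (1 + ‖fderiv ℝ G x‖) * (‖A‖ + ‖P‖) * ‖n‖ * ‖X‖ * ‖Y‖ * ‖Z‖ := by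
  have hs0 : 0 ≤ s := zero_le_one.trans h1s
  set D := ‖fderiv ℝ G x‖ with hD
  have hD0 : 0 ≤ D := norm_nonneg _
  -- elementary pieces
  have hSop : ∀ α : E →L[ℝ] ℝ, ‖sharpAt G x α‖ ≤ s * ‖α‖ := fun α ↦
    (le_opNorm _ _).trans (mul_le_mul_of_nonneg_right hs (norm_nonneg _))
  have hdK : ∀ a c : E, ‖n a • A c + n c • A.flip a - A a c • n‖ ≤ 3 * ‖n‖ * ‖A‖ * ‖a‖ * ‖c‖ := by
    intro a c
    have e1 : ‖n a • A c‖ ≤ ‖n‖ * ‖a‖ * (‖A‖ * ‖c‖) := by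
      rw [norm_smul]
      exact mul_le_mul (le_opNorm _ _) (le_opNorm _ _) (norm_nonneg _) (by positivity)
    have e2 : ‖n c • A.flip a‖ ≤ ‖n‖ * ‖c‖ * (‖A‖ * ‖a‖) := by
      rw [norm_smul]
      refine mul_le_mul (le_opNorm _ _) ?_ (norm_nonneg _) (by positivity)
      exact (le_opNorm _ _).trans (by rw [opNorm_flip])
    have e3 : ‖A a c • n‖ ≤ ‖A‖ * ‖a‖ * ‖c‖ * ‖n‖ := by
      rw [norm_smul]
      refine mul_le_mul_of_nonneg_right ?_ (norm_nonneg _)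
      exact (le_opNorm _ _).trans (mul_le_mul_of_nonneg_right (le_opNorm _ _) (norm_nonneg _))
    calc _ ≤ ‖n‖ * ‖a‖ * (‖A‖ * ‖c‖) + ‖n‖ * ‖c‖ * (‖A‖ * ‖a‖) + ‖A‖ * ‖a‖ * ‖c‖ * ‖n‖ :=
          norm_sub_le_of_le (norm_add_le_of_le e1 e2) e3
      _ = 3 * ‖n‖ * ‖A‖ * ‖a‖ * ‖c‖ := by ring
  have hK : ∀ a c : E, ‖koszulCLM G x a c‖ ≤ 3 * D * ‖a‖ * ‖c‖ := fun a c ↦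
    (le_opNorm _ _).trans (mul_le_mul_of_nonneg_right (norm_koszulCLM_apply_le (G := G) a)
      (norm_nonneg _))
  have hΓ : ∀ a : E, ‖chrAt G x a‖ ≤ 2⁻¹ * 3 * s * D * ‖a‖ := by
    intro a
    calc ‖chrAt G x a‖ ≤ 2⁻¹ * (‖sharpAt G x‖ * (3 * ‖fderiv ℝ G x‖ * ‖a‖)) := norm_chrAt_apply_le a
      _ ≤ 2⁻¹ * (s * (3 * D * ‖a‖)) := by rw [hD]; gcongr
      _ = 2⁻¹ * 3 * s * D * ‖a‖ := by ring
  have hΓ₂ : ∀ a c : E, ‖chrAt G x a c‖ ≤ 2⁻¹ * 3 * s * D * ‖a‖ * ‖c‖ := fun a c ↦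
    (le_opNorm _ _).trans (mul_le_mul_of_nonneg_right (hΓ a) (norm_nonneg _))
  have hDS : ∀ v : E, ‖fderiv ℝ (sharpAt G) x v‖ ≤ s * D * s * ‖v‖ := by
    intro v
    calc _ ≤ ‖sharpAt G x‖ * ‖fderiv ℝ G x‖ * ‖sharpAt G x‖ * ‖v‖ :=
          hG.norm_fderiv_sharpAt_apply_le hx v
      _ ≤ s * D * s * ‖v‖ := by rw [hD]; gcongr
  have hT : ∀ a : E, ‖n a • P + n.smulRight (P a)‖ ≤ 2 * ‖n‖ * ‖P‖ * ‖a‖ := by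
    intro a
    have e1 : ‖n a • P‖ ≤ ‖n‖ * ‖a‖ * ‖P‖ := by
      rw [norm_smul]
      exact mul_le_mul_of_nonneg_right (le_opNorm _ _) (norm_nonneg _)
    have e2 : ‖n.smulRight (P a)‖ ≤ ‖n‖ * (‖P‖ * ‖a‖) := by
      rw [norm_smulRight_apply]
      exact mul_le_mul_of_nonneg_left (le_opNorm _ _) (norm_nonneg _)
    calc _ ≤ ‖n‖ * ‖a‖ * ‖P‖ + ‖n‖ * (‖P‖ * ‖a‖) := norm_add_le_of_le e1 e2
      _ = 2 * ‖n‖ * ‖P‖ * ‖a‖ := by ring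
  have hkos : ∀ (T : E →L[ℝ] E →L[ℝ] E →L[ℝ] ℝ) (a c : E), ‖koszulOp T a c‖ ≤ 3 * ‖T‖ * ‖a‖ * ‖c‖ :=
    fun T a c ↦ (le_opNorm _ _).trans (mul_le_mul_of_nonneg_right (norm_koszulOp_apply_le T a)
      (norm_nonneg _))
  -- the five terms of `F(X, Y)`; the linear part is `F(X,Y) − F(Y,X)`
  have hF : ∀ X Y : E,
      ‖(2⁻¹ : ℝ) • (fderiv ℝ (sharpAt G) x X (n Y • A Z + n Z • A.flip Y - A Y Z • n)
          - n X • sharpAt G x (A (sharpAt G x (koszulCLM G x Y Z)))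
          + sharpAt G x (koszulOp (n X • P + n.smulRight (P X)) Y Z))
        + (chrAt G x X ((2⁻¹ : ℝ) • sharpAt G x (n Y • A Z + n Z • A.flip Y - A Y Z • n))
          + (2⁻¹ : ℝ) • sharpAt G x (n X • A (chrAt G x Y Z) + n (chrAt G x Y Z) • A.flip X
            - A X (chrAt G x Y Z) • n))‖
        ≤ 2⁻¹ * 15 * (s ^ 2 * D * ‖n‖ * ‖A‖ * ‖X‖ * ‖Y‖ * ‖Z‖)
          + 3 * (s * ‖n‖ * ‖P‖ * ‖X‖ * ‖Y‖ * ‖Z‖) := by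
    intro X Y
    have t1a : ‖fderiv ℝ (sharpAt G) x X (n Y • A Z + n Z • A.flip Y - A Y Z • n)‖
        ≤ 3 * (s ^ 2 * D * ‖n‖ * ‖A‖ * ‖X‖ * ‖Y‖ * ‖Z‖) :=
      calc _ ≤ ‖fderiv ℝ (sharpAt G) x X‖ * ‖(n Y • A Z + n Z • A.flip Y - A Y Z • n)‖ := le_opNorm _ _
        _ ≤ (s * D * s * ‖X‖) * (3 * ‖n‖ * ‖A‖ * ‖Y‖ * ‖Z‖) :=
            mul_le_mul (hDS X) (hdK Y Z) (norm_nonneg _) (by positivity)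
        _ = _ := by ring
    have t1b : ‖n X • sharpAt G x (A (sharpAt G x (koszulCLM G x Y Z)))‖
        ≤ 3 * (s ^ 2 * D * ‖n‖ * ‖A‖ * ‖X‖ * ‖Y‖ * ‖Z‖) := by
      rw [norm_smul]
      calc _ ≤ (‖n‖ * ‖X‖) * (s * (‖A‖ * (s * (3 * D * ‖Y‖ * ‖Z‖)))) := by
            refine mul_le_mul (le_opNorm _ _) ?_ (norm_nonneg _) (by positivity)
            refine (hSop _).trans (mul_le_mul_of_nonneg_left ?_ hs0)
            refine (le_opNorm _ _).trans (mul_le_mul_of_nonneg_left ?_ (norm_nonneg _))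
            exact (hSop _).trans (mul_le_mul_of_nonneg_left (hK Y Z) hs0)
        _ = _ := by ring
    have t1c : ‖sharpAt G x (koszulOp (n X • P + n.smulRight (P X)) Y Z)‖
        ≤ 6 * (s * ‖n‖ * ‖P‖ * ‖X‖ * ‖Y‖ * ‖Z‖) :=
      calc _ ≤ s * (3 * (2 * ‖n‖ * ‖P‖ * ‖X‖) * ‖Y‖ * ‖Z‖) := by
            refine (hSop _).trans (mul_le_mul_of_nonneg_left ?_ hs0)
            refine (hkos _ Y Z).trans ?_
            gcongr
            exact hT X
        _ = _ := by ring
    have t3a : ‖chrAt G x X ((2⁻¹ : ℝ) • sharpAt G x (n Y • A Z + n Z • A.flip Y - A Y Z • n))‖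
        ≤ 4⁻¹ * 9 * (s ^ 2 * D * ‖n‖ * ‖A‖ * ‖X‖ * ‖Y‖ * ‖Z‖) :=
      calc _ ≤ (2⁻¹ * 3 * s * D * ‖X‖) * (2⁻¹ * (s * (3 * ‖n‖ * ‖A‖ * ‖Y‖ * ‖Z‖))) := by
            refine (le_opNorm _ _).trans (mul_le_mul (hΓ X) ?_ (norm_nonneg _) (by positivity))
            rw [norm_smul, Real.norm_eq_abs, abs_of_pos (by norm_num : (0 : ℝ) < 2⁻¹)]
            refine mul_le_mul_of_nonneg_left ?_ (by norm_num)
            exact (hSop _).trans (mul_le_mul_of_nonneg_left (hdK Y Z) hs0)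
        _ = _ := by ring
    have t3b : ‖(2⁻¹ : ℝ) • sharpAt G x (n X • A (chrAt G x Y Z) + n (chrAt G x Y Z) • A.flip X
          - A X (chrAt G x Y Z) • n)‖
        ≤ 4⁻¹ * 9 * (s ^ 2 * D * ‖n‖ * ‖A‖ * ‖X‖ * ‖Y‖ * ‖Z‖) := by
      rw [norm_smul, Real.norm_eq_abs, abs_of_pos (by norm_num : (0 : ℝ) < 2⁻¹)]
      calc _ ≤ 2⁻¹ * (s * (3 * ‖n‖ * ‖A‖ * ‖X‖ * (2⁻¹ * 3 * s * D * ‖Y‖ * ‖Z‖))) := by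
            refine mul_le_mul_of_nonneg_left ?_ (by norm_num)
            refine (hSop _).trans (mul_le_mul_of_nonneg_left ?_ hs0)
            refine (hdK X (chrAt G x Y Z)).trans ?_
            gcongr
            exact hΓ₂ Y Z
        _ = _ := by ring
    have hsum := norm_add_le_of_le
      (norm_add_le_of_le (norm_sub_le_of_le t1a t1b) t1c) (norm_add_le_of_le t3a t3b)
    calc _ ≤ 2⁻¹ * (3 * (s ^ 2 * D * ‖n‖ * ‖A‖ * ‖X‖ * ‖Y‖ * ‖Z‖)
            + 3 * (s ^ 2 * D * ‖n‖ * ‖A‖ * ‖X‖ * ‖Y‖ * ‖Z‖)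
            + 6 * (s * ‖n‖ * ‖P‖ * ‖X‖ * ‖Y‖ * ‖Z‖))
          + (4⁻¹ * 9 * (s ^ 2 * D * ‖n‖ * ‖A‖ * ‖X‖ * ‖Y‖ * ‖Z‖)
            + 4⁻¹ * 9 * (s ^ 2 * D * ‖n‖ * ‖A‖ * ‖X‖ * ‖Y‖ * ‖Z‖)) := by
          refine norm_add_le_of_le ?_ (norm_add_le_of_le t3a t3b)
          rw [norm_smul, Real.norm_eq_abs, abs_of_pos (by norm_num : (0 : ℝ) < 2⁻¹)]
          exact mul_le_mul_of_nonneg_left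
            (norm_add_le_of_le (norm_sub_le_of_le t1a t1b) t1c) (by norm_num)
      _ = _ := by ring
  -- assemble `Lin = F(X,Y) − F(Y,X)`
  rw [sub_add_eq_add_sub, sub_sub]
  have hXY := hF X Y
  have hYX := hF Y X
  have hm0 : 0 ≤ s ^ 2 * ‖n‖ * ‖X‖ * ‖Y‖ * ‖Z‖ * (15 * ‖A‖ + 9 * ‖P‖ + 15 * D * ‖P‖) := by
    positivity
  have hss : s ≤ s ^ 2 := by
    calc s = s * 1 := (mul_one s).symm
      _ ≤ s * s := mul_le_mul_of_nonneg_left h1s hs0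
      _ = s ^ 2 := (sq s).symm
  have hsP : s * (‖n‖ * ‖P‖ * ‖X‖ * ‖Y‖ * ‖Z‖) ≤ s ^ 2 * (‖n‖ * ‖P‖ * ‖X‖ * ‖Y‖ * ‖Z‖) :=
    mul_le_mul_of_nonneg_right hss (by positivity)
  calc _ ≤ (2⁻¹ * 15 * (s ^ 2 * D * ‖n‖ * ‖A‖ * ‖X‖ * ‖Y‖ * ‖Z‖)
            + 3 * (s * ‖n‖ * ‖P‖ * ‖X‖ * ‖Y‖ * ‖Z‖))
          + (2⁻¹ * 15 * (s ^ 2 * D * ‖n‖ * ‖A‖ * ‖Y‖ * ‖X‖ * ‖Z‖)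
            + 3 * (s * ‖n‖ * ‖P‖ * ‖Y‖ * ‖X‖ * ‖Z‖)) := norm_sub_le_of_le hXY hYX
    _ = 15 * (s ^ 2 * D * ‖n‖ * ‖A‖ * ‖X‖ * ‖Y‖ * ‖Z‖)
          + 6 * (s * (‖n‖ * ‖P‖ * ‖X‖ * ‖Y‖ * ‖Z‖)) := by ring
    _ ≤ 15 * (s ^ 2 * D * ‖n‖ * ‖A‖ * ‖X‖ * ‖Y‖ * ‖Z‖)
          + 6 * (s ^ 2 * (‖n‖ * ‖P‖ * ‖X‖ * ‖Y‖ * ‖Z‖)) := by linarith [hsP]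
    _ ≤ 15 * (s ^ 2 * D * ‖n‖ * ‖A‖ * ‖X‖ * ‖Y‖ * ‖Z‖)
          + 6 * (s ^ 2 * (‖n‖ * ‖P‖ * ‖X‖ * ‖Y‖ * ‖Z‖))
          + s ^ 2 * ‖n‖ * ‖X‖ * ‖Y‖ * ‖Z‖ * (15 * ‖A‖ + 9 * ‖P‖ + 15 * D * ‖P‖) :=
        le_add_of_nonneg_right hm0
    _ = 15 * s ^ 2 * (1 + D) * (‖A‖ + ‖P‖) * ‖n‖ * ‖X‖ * ‖Y‖ * ‖Z‖ := by ring

/-- **The bound on the momentum row.** Under the jet hypotheses of `riemAt_apply_eq_add_of_jet₁`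
with `A` symmetric, `n(e) = 0`, `‖♯‖ ≤ s`, `1 ≤ s`, in any basis `b`:
`|Ric'(♯n, e) − Ric(♯n, e)| ≤ (Σᵢ ‖bⁱ‖‖bᵢ‖) · 15 s³ (1 + ‖DG(x)‖)(‖A‖ + ‖P‖)‖n‖²‖e‖`
(`momRow_ricAt_sub_eq_sum` and `momRow_norm_lin_le` with `‖♯n‖ ≤ s‖n‖`): linear in the jet data,
at most linear in `‖DG(x)‖`, blind to `D²G(x)` and to `W`. [cite: ONeill1983, Ch. 3, Lemma 3.52] -/
theorem momRow_abs_ricAt_sub_le [FiniteDimensional ℝ E] {ι : Type*} [Fintype ι]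
    (hG : IsMetricOn G V) (hG' : IsMetricOn G' V)
    (hx : x ∈ V) (h0 : G' x = G x) (h1 : fderiv ℝ G' x = fderiv ℝ G x + n.smulRight A)
    {P : E →L[ℝ] E →L[ℝ] E →L[ℝ] ℝ} {W : E →L[ℝ] E →L[ℝ] ℝ}
    (h2 : ∀ v, fderiv ℝ (fderiv ℝ G') x v =
      fderiv ℝ (fderiv ℝ G) x v + (n v • P + n.smulRight (P v) + n v • n.smulRight W))
    (hA : ∀ v w : E, A v w = A w v) {e : E} (he : n e = 0) (b : Module.Basis ι ℝ E)
    {s : ℝ} (h1s : 1 ≤ s) (hs : ‖sharpAt G x‖ ≤ s) :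
    |ricAt G' x (sharpAt G x n) e - ricAt G x (sharpAt G x n) e|
      ≤ (∑ i, ‖LinearMap.toContinuousLinearMap (b.coord i)‖ * ‖b i‖)
        * (15 * s ^ 3 * (1 + ‖fderiv ℝ G x‖) * (‖A‖ + ‖P‖) * ‖n‖ ^ 2 * ‖e‖) := by
  have hs0 : 0 ≤ s := zero_le_one.trans h1s
  rw [momRow_ricAt_sub_eq_sum hG hG' hx h0 h1 h2 hA he b, Finset.sum_mul]
  refine (Finset.abs_sum_le_sum_abs _ _).trans (Finset.sum_le_sum fun i _ ↦ ?_)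
  have hY : ‖sharpAt G x n‖ ≤ s * ‖n‖ :=
    (le_opNorm _ _).trans (mul_le_mul_of_nonneg_right hs (norm_nonneg _))
  have hL := momRow_norm_lin_le (n := n) (A := A) hG hx h1s hs P (b i) (sharpAt G x n) e
  have hc : ∀ v : E, |b.coord i v| ≤ ‖LinearMap.toContinuousLinearMap (b.coord i)‖ * ‖v‖ := by
    intro v
    rw [← Real.norm_eq_abs, ← LinearMap.coe_toContinuousLinearMap' (b.coord i)]
    exact le_opNorm _ _
  calc _ ≤ ‖LinearMap.toContinuousLinearMap (b.coord i)‖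
        * (15 * s ^ 2 * (1 + ‖fderiv ℝ G x‖) * (‖A‖ + ‖P‖) * ‖n‖ * ‖b i‖ * (s * ‖n‖) * ‖e‖) := by
        refine (hc _).trans (mul_le_mul_of_nonneg_left (hL.trans ?_) (norm_nonneg _))
        gcongr
    _ = _ := by ring

end Bound

/-- **Registered stub ML (`stub_momRowLinear`) of skeleton r13 — the momentum rows are linear in
the normal jet data.** (i) LINEARITY: for metric fields `G, G₁, G₂, G₃` on `V ∋ x` with the same
value at `x`, first jets `DGₖ(x) = DG(x) + n ⊗ Aₖ` with `A₃ = c₁A₁ + c₂A₂`, second jets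
`D²Gₖ(x)(v) = D²G(x)(v) + n(v)Pₖ + n ⊗ Pₖ(v) + n(v) n ⊗ Wₖ` with `P₃ = c₁P₁ + c₂P₂` (`W₃`
arbitrary) and `n(e) = 0`:
`Row(G₃) − Row(G) = c₁(Row(G₁) − Row(G)) + c₂(Row(G₂) − Row(G))`, `Row(G') = Ric(G')(♯_G n, e)`;
(ii) BOUND: for `G(x)` `μ`-coercive, `|Row(G₁) − Row(G)| ≤ C (1 + ‖DG(x)‖)(‖A‖ + ‖P‖)‖n‖²‖e‖`.
Both from the momentum-row formula `momRow_ricAt_sub_eq_sum` (the `W`-part and the `A`-quadratic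
part of the exact curvature change have no `(♯n, ker n)` trace), its linearity and its bound; the
case `n = 0` is trivial, otherwise `A` is symmetric (`momRow_symm_of_jet₁`).  In ADM language:
the momentum constraint `G⁰ⱼ = −(DᵢKⁱⱼ − Dⱼ tr K)/N` is linear in `K` (contracted Codazzi
equation). [cite: ONeill1983, Ch. 3, Lemma 3.52] -/
theorem stub_momRowLinear :
    (∀ {G G₁ G₂ G₃ : E4 → E4 →L[ℝ] E4 →L[ℝ] ℝ} {V : Set E4} {x : E4} {n : E4 →L[ℝ] ℝ} {A₁ A₂ : E4 →L[ℝ] E4 →L[ℝ] ℝ} {P₁ P₂ : E4 →L[ℝ] E4 →L[ℝ] E4 →L[ℝ] ℝ} {W₁ W₂ W₃ : E4 →L[ℝ] E4 →L[ℝ] ℝ} (c₁ c₂ : ℝ), MetricCoord.IsMetricOn G V → MetricCoord.IsMetricOn G₁ V → MetricCoord.IsMetricOn G₂ V → MetricCoord.IsMetricOn G₃ V → x ∈ V → G₁ x = G x → G₂ x = G x → G₃ x = G x → fderiv ℝ G₁ x = fderiv ℝ G x + n.smulRight A₁ → fderiv ℝ G₂ x = fderiv ℝ G x + n.smulRight A₂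 → fderiv ℝ G₃ x = fderiv ℝ G x + n.smulRight (c₁ • A₁ + c₂ • A₂) → (∀ v, fderiv ℝ (fderiv ℝ G₁) x v = fderiv ℝ (fderiv ℝ G) x v + (n v • P₁ + n.smulRight (P₁ v) + n v • n.smulRight W₁)) → (∀ v, fderiv ℝ (fderiv ℝ G₂) x v = fderiv ℝ (fderiv ℝ G) x v + (n v • P₂ + n.smulRight (P₂ v) + n v • n.smulRight W₂)) → (∀ v, fderiv ℝ (fderiv ℝ G₃) x v = fderiv ℝ (fderiv ℝ G) x v + (n v • (c₁ • P₁ + c₂ • P₂) + n.smulRight ((c₁ • P₁ + c₂ • P₂) v) + n v • n.smulRight W₃)) → ∀ e : E4, n e = 0 → MetricCoord.ricAt G₃ x (MetricCoord.sharpAt G x n) e - MetricCoord.ricAt G x (MetricCoord.sharpAt G x n) e = c₁ * (MetricCoord.ricAt G₁ x (MetricCoord.sharpAt G x n) e - MetricCoord.ricAt G x (MetricCoord.sharpAt G x n) e) + c₂ * (MetricCoord.ricAt G₂ x (MetricCoord.sharpAt G x n) e - MetricCoord.ricAt G x (MetricCoord.sharpAt G x n) e)) ∧ (∀ μ ν :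 ℝ, 0 < μ → ∃ C : ℝ, ∀ {G G₁ : E4 → E4 →L[ℝ] E4 →L[ℝ] ℝ} {V : Set E4} {x : E4} {n : E4 →L[ℝ] ℝ} {A : E4 →L[ℝ] E4 →L[ℝ] ℝ} {P : E4 →L[ℝ] E4 →L[ℝ] E4 →L[ℝ] ℝ} {W : E4 →L[ℝ] E4 →L[ℝ] ℝ}, MetricCoord.IsMetricOn G V → MetricCoord.IsMetricOn G₁ V → x ∈ V → (∀ v : E4, μ * ‖v‖ ≤ ‖G x v‖) → ‖G x‖ ≤ ν → G₁ x = G x → fderiv ℝ G₁ x = fderiv ℝ G x + n.smulRight A → (∀ v, fderiv ℝ (fderiv ℝ G₁) x v = fderiv ℝ (fderiv ℝ G) x v + (n v • P + n.smulRight (P v) + n v • n.smulRight W)) → ∀ e : E4, n e = 0 → |MetricCoord.ricAt G₁ x (MetricCoord.sharpAt G x n) e - MetricCoord.ricAt G x (MetricCoord.sharpAt G x n) e| ≤ C * (1 + ‖fderiv ℝ G x‖) * (‖A‖ + ‖P‖) * ‖n‖ ^ 2 * ‖e‖) := by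
  refine ⟨?_, ?_⟩
  · intro G G₁ G₂ G₃ V x n A₁ A₂ P₁ P₂ W₁ W₂ W₃ c₁ c₂ hG hG₁ hG₂ hG₃ hx h0₁ h0₂ h0₃ h1₁ h1₂ h1₃
      h2₁ h2₂ h2₃ e he
    by_cases hn : n = 0
    · subst hn
      simp only [map_zero, _root_.zero_apply, sub_self, mul_zero, add_zero]
    · obtain ⟨v, hv⟩ : ∃ v, n v ≠ 0 := by simpa using DFunLike.ne_iff.mp hn
      have hA₁ := momRow_symm_of_jet₁ hG hG₁ hx h1₁ hv
      have hA₂ := momRow_symm_of_jet₁ hG hG₂ hx h1₂ hv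
      have hA₃ := momRow_symm_of_jet₁ hG hG₃ hx h1₃ hv
      rw [momRow_ricAt_sub_eq_sum hG hG₃ hx h0₃ h1₃ h2₃ hA₃ he (Module.finBasis ℝ E4),
        momRow_ricAt_sub_eq_sum hG hG₁ hx h0₁ h1₁ h2₁ hA₁ he (Module.finBasis ℝ E4),
        momRow_ricAt_sub_eq_sum hG hG₂ hx h0₂ h1₂ h2₂ hA₂ he (Module.finBasis ℝ E4),
        momRow_sum_coord_lin_lincomb]
  · intro μ ν hμ
    refine ⟨(∑ i, ‖LinearMap.toContinuousLinearMap ((Module.finBasis ℝ E4).coord i)‖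
        * ‖(Module.finBasis ℝ E4) i‖) * (15 * (max 1 μ⁻¹) ^ 3), ?_⟩
    intro G G₁ V x n A P W hG hG₁ hx hcoer _hν h0 h1 h2 e he
    by_cases hn : n = 0
    · subst hn
      simp only [map_zero, _root_.zero_apply, sub_self, abs_zero, norm_zero]
      positivity
    · obtain ⟨v, hv⟩ : ∃ v, n v ≠ 0 := by simpa using DFunLike.ne_iff.mp hn
      have hA := momRow_symm_of_jet₁ hG hG₁ hx h1 hv
      have h1s : (1 : ℝ) ≤ max 1 μ⁻¹ := le_max_left _ _
      have hS : ‖MetricCoord.sharpAt G x‖ ≤ max 1 μ⁻¹ :=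
        (norm_sharpAt_le_of_coercive hμ hcoer (hG.isInvertible x hx)).trans (le_max_right _ _)
      calc _ ≤ _ := momRow_abs_ricAt_sub_le hG hG₁ hx h0 h1 h2 hA he (Module.finBasis ℝ E4) h1s hS
        _ = _ := by ring

end Summit.FinalStateConjecture.FinalStateConjecture.Theorems.SublinearIsFree.Slaving
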